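import Literature.MathematicalPhysics.QuantumFieldTheory.Balaban1983to89.Node00.TorusCoverBlockAveragingZd

/-!
# NODE 00 — THE TORUS→`ℤᵈ` TWIN, FILE 39b: [6]'s CLASS `A_k` ((1.7)∕(1.9), `B8Ineq132.CondAt ∕ InAk` — class-0, kept verbatim by the N05-REC twins) IS TRANSLATION-COVARIANT
# (`InAk … Ω (V∘(·+t)) ↔ InAk … (Ω+t) V`), so the TOP-ANCHORED lift of FILE 39 (`x ↦ ι(U⟨π(x + (Lᵏ−1)∕2·𝟙), μ⟩)`) inherits its input class from the run's (1.4)-type bounds exactly as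
# the unshifted lift does (dag-n07-e's `TorusCoverGaugeLift.inAk_zdLift_of_top`), on the translated cover family

Cell `pub-ymgap`, width seat `pub-ymgap-dag-n07-w3` generation 9 (torus push-down lineage), N05-REC road item R7, INPUT side (A1) of the door plan `HOME/pub-ymgap-dag-n07-w3/R7-DOOR-PLAN.md`:
`HThm4Rec`'s torus hypotheses `PlaqSmallOn (omegaPlaqsTop …) (ε_n·η_n²) U`, `CoDivSmallOn (omegaBondsTop …) (ε_n·η_n³) U` ⟹ the twin crown's input class `InAk` for the lift the
dictionary files (39∕40∕41) are stated on.  `--kind proof --supports stmt-QuantumFields-20541` (K0⁷; count-neutral; THEOREMS ONLY, 0 `def`).  CONSUMED BY NAME, nothing modified: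
lit-balaban's `B8Ineq132` (`plaqF covDeriv covDiv PlaqTouches BondTouches CondAt InAk`), dag-n07-e's `TorusCoverGaugeLift.inAk_zdLift_of_top`, FILE 39's `hol_translate`.
[6] = [Balaban1985RegularSpaces]; [III] = [Balaban1988Convergent]; [I] = [Balaban1987RG1].

WHAT IS PROVED (kernel; generic `𝔸` in §1; NO estimate — translation bookkeeping).
§1 (private `add_mem_image_add_iff`), `plaqTouches_translate_iff`, `bondTouches_translate_iff`, `plaqF_translate`, `covDeriv_translate`, `covDiv_translate`, ★ `condAt_translate_iff`
   (`CondAt L η α j S (V∘(·+t)) ↔ CondAt L η α j (S+t) V`), ★ `inAk_translate_iff`.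
§2 ★★ `inAk_coverLiftShift_of_top` — `inAk_zdLift_of_top` for the translated lift: same torus scales `lvl j ≤ kT`, same tolerances, the inclusion hypothesis on the TRANSLATED cover
   family `cover ″ (Ω′ j + t) ⊆ Ω_{lvl j}` (the transcription's centred cubes = NODE 00 label cubes shifted by `−t`, ⚑ LOCATED-L1 of the cell bus 2026-08-29).
NOT HERE: which `Ω′` the twin's cube datum uses (n05-d∕n05-e's `CubeB8DZ`, R4∕R0c); any estimate.
HONEST FRAMING: count-neutral helper; translation bookkeeping — nothing of [6]∕[III]∕[I] asserted or discharged; `HThm4Rec` UNDISCHARGED (caveat (C-S3-1)); N07 ∕ N05 NOT discharged,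
N07 NOT claimable on road (β); counts unmoved; one finite 𝕋⁴ programme at fixed ε — R4 closes the conditional finite-𝕋⁴ rung `BalabanLadder.UV` only; the YM mass gap (Clay) is NOT
proved by any of this; nothing continuum ∕ ℝ⁴ ∕ OS.  No `def`, no `sorry`, no `instance`, no `notation`.
-/

set_option autoImplicit false

noncomputable section

open scoped BigOperators Matrix.Norms.L2Operator

namespace Literature.MathematicalPhysics.QuantumFieldTheory.Balaban1983to89.Node00

open B15Eq112TorusCover (cover)
open B14DomainGeom (Pt)
open B7Prop1Explicit (e hol plaqWord)
open B7Eq78Linearization (conjR)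
open B8Ineq132 (plaqF covDeriv covDiv PlaqTouches BondTouches CondAt InAk)

/-! ## §1  Translating the configuration = translating the domains ([6] (1.7)∕(1.9) are translation-covariant) -/

section Translate

variable {d : ℕ} {𝔸 : Type*} [NormedRing 𝔸]

/-- `x + t` lies in the translate `S + t` iff `x ∈ S`. [folklore] -/
private theorem add_mem_image_add_iff (S : Set (B7Prop1Explicit.Site d)) (t x : B7Prop1Explicit.Site d) :
    x + t ∈ (fun y => y + t) '' S ↔ x ∈ S := by
  constructor
  · rintro ⟨y, hy, hyx⟩
    have : y = x := add_right_cancel hyx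
    exact this ▸ hy
  · exact fun hx => ⟨x, hx, rfl⟩

/-- `PlaqTouches` is translation-covariant. [cite: Balaban1985RegularSpaces, p.77 (convention before (1.5))] -/
theorem plaqTouches_translate_iff (S : Set (B7Prop1Explicit.Site d)) (t x : B7Prop1Explicit.Site d) (μ ν : Fin d) :
    PlaqTouches ((fun y => y + t) '' S) (x + t) μ ν ↔ PlaqTouches S x μ ν := by
  unfold PlaqTouches
  rw [show x + t + e μ = (x + e μ) + t by abel, show x + t + e ν = (x + e ν) + t by abel,
    show x + e μ + t + e ν = (x + e μ + e ν) + t by abel]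
  simp only [add_mem_image_add_iff]

/-- `BondTouches` is translation-covariant. [cite: Balaban1985RegularSpaces, p.77 (convention before (1.5))] -/
theorem bondTouches_translate_iff (S : Set (B7Prop1Explicit.Site d)) (t x : B7Prop1Explicit.Site d) (μ : Fin d) :
    BondTouches ((fun y => y + t) '' S) (x + t) μ ↔ BondTouches S x μ := by
  unfold BondTouches
  rw [show x + t + e μ = (x + e μ) + t by abel]
  simp only [add_mem_image_add_iff]

/-- The plaquette variables (1.2) of the translated configuration. [cite: Balaban1985RegularSpaces, (1.2) p.76] -/
theorem plaqF_translate (V : B7Prop1Explicit.Site d → Fin d → 𝔸ˣ) (t : B7Prop1Explicit.Site d) (μ ν : Fin d) (x : B7Prop1Explicit.Site d) :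
    plaqF (fun y κ => V (y + t) κ) μ ν x = plaqF V μ ν (x + t) := by
  unfold plaqF
  rw [hol_translate]

variable [NormedAlgebra ℂ 𝔸]

/-- The backward covariant derivative (1.1) of a translated pair (configuration, function). [cite: Balaban1985RegularSpaces, (1.1) p.76] -/
theorem covDeriv_translate (η : ℝ) (V : B7Prop1Explicit.Site d → Fin d → 𝔸ˣ) (t : B7Prop1Explicit.Site d) (ν : Fin d)
    (F : B7Prop1Explicit.Site d → 𝔸) (x : B7Prop1Explicit.Site d) :
    covDeriv η (fun y κ => V (y + t) κ) ν (fun y => F (y + t)) x = covDeriv η V ν F (x + t) := by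
  unfold covDeriv
  dsimp only
  rw [show x - e ν + t = x + t - e ν by abel]

/-- The covariant co-divergence (1.2) of the translated configuration. [cite: Balaban1985RegularSpaces, (1.2) p.76] -/
theorem covDiv_translate (η : ℝ) (V : B7Prop1Explicit.Site d → Fin d → 𝔸ˣ) (t : B7Prop1Explicit.Site d) (μ : Fin d) (x : B7Prop1Explicit.Site d) :
    covDiv η (fun y κ => V (y + t) κ) μ x = covDiv η V μ (x + t) := by
  unfold covDiv
  have h : ∀ ν μ' : Fin d, (plaqF (fun y κ => V (y + t) κ) ν μ') = fun y => plaqF V ν μ' (y + t) := fun ν μ' => funext (plaqF_translate V t ν μ')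
  simp only [h, covDeriv_translate]

/-- ★ **[6] (1.7) ∧ (1.9) AT SCALE `j` FOR THE TRANSLATED CONFIGURATION = FOR THE TRANSLATED DOMAIN**: `CondAt L η α j S (V ∘ (· + t)) ↔ CondAt L η α j (S + t) V`.
[cite: Balaban1985RegularSpaces, (1.7), (1.9) p.77] -/
theorem condAt_translate_iff (L : ℕ) (η α : ℝ) (j : ℕ) (S : Set (B7Prop1Explicit.Site d)) (V : B7Prop1Explicit.Site d → Fin d → 𝔸ˣ)
    (t : B7Prop1Explicit.Site d) :
    CondAt L η α j S (fun y κ => V (y + t) κ) ↔ CondAt L η α j ((fun y => y + t) '' S) V := by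
  unfold CondAt
  simp only [plaqF_translate, covDiv_translate]
  constructor
  · rintro ⟨h1, h2⟩
    refine ⟨fun x μ ν hμν hx => ?_, fun x μ hx => ?_⟩
    · have := h1 (x - t) μ ν hμν (by rwa [← plaqTouches_translate_iff S t, sub_add_cancel])
      rwa [sub_add_cancel] at this
    · have := h2 (x - t) μ (by rwa [← bondTouches_translate_iff S t, sub_add_cancel])
      rwa [sub_add_cancel] at this
  · rintro ⟨h1, h2⟩
    exact ⟨fun x μ ν hμν hx => h1 (x + t) μ ν hμν ((plaqTouches_translate_iff S t x μ ν).mpr hx),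
      fun x μ hx => h2 (x + t) μ ((bondTouches_translate_iff S t x μ).mpr hx)⟩

/-- ★ **THE CLASS `A_k` OF THE TRANSLATED CONFIGURATION IS THE CLASS ON THE TRANSLATED DOMAINS**: `InAk L k η α Ω (V ∘ (· + t)) ↔ InAk L k η α (Ω + t) V`.
[cite: Balaban1985RegularSpaces, (1.7)–(1.9) p.77] -/
theorem inAk_translate_iff (L k : ℕ) (η α : ℝ) (Ω : ℕ → Set (B7Prop1Explicit.Site d)) (V : B7Prop1Explicit.Site d → Fin d → 𝔸ˣ)
    (t : B7Prop1Explicit.Site d) :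
    InAk L k η α Ω (fun y κ => V (y + t) κ) ↔ InAk L k η α (fun j => (fun y => y + t) '' Ω j) V := by
  unfold InAk
  simp only [condAt_translate_iff]

end Translate

/-! ## §2  The TOP-ANCHORED lift's input class from the torus class bounds of the run -/

section Lift

variable {P : Params} (N : ℕ) [NeZero N]

/-- ★★ **THE RUN's (1.4)-TYPE BOUNDS GIVE [6]'s `A_k` FOR THE TOP-ANCHORED LIFT** (FILE 39's convention `V x μ := ι(U⟨π(x + t), μ⟩)`, `t = (Lᵏ−1)∕2·𝟙`): dag-n07-e's
`TorusCoverGaugeLift.inAk_zdLift_of_top` read through the translation `inAk_translate_iff` — the torus scales `lvl j`, the tolerances and the inclusion of the cover images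
are as there, the cover family being the TRANSLATED one `Ω′ j + t` (the transcription's centred cubes sit at the NODE 00 label cubes shifted by `−t`, ⚑ LOCATED-L1).
[cite: Balaban1985RegularSpaces, (1.7)–(1.9) p.77; Balaban1988Convergent, (1.4) p.247; Balaban1987RG1, (0.1) p.251] -/
theorem inAk_coverLiftShift_of_top {Ω : ℕ → Set (Site P 0)} {Ω₀ : Set (Site P 0)} {kT : ℕ} {ε : ℕ → ℝ} (U : GaugeField P 0 (SU N))
    (hP : ∀ m, m ≤ kT → PlaqSmallOn (Sect2.omegaPlaqsTop Ω Ω₀ m) (ε m * P.eta m ^ 2) U)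
    (hD : ∀ m, m ≤ kT → Sect2.CoDivSmallOn (Sect2.omegaBondsTop Ω Ω₀ m) (ε m * P.eta m ^ 3) U)
    (t : Pt P.d) {Ω' : ℕ → Set (B7Prop1Explicit.Site P.d)} {k : ℕ} {α η : ℝ} (hη : 0 < η) (lvl : ℕ → ℕ)
    (hlvl : ∀ j, j ≤ k → lvl j ≤ kT)
    (hsub : ∀ j, j ≤ k → cover P '' ((fun y => y + t) '' Ω' j) ⊆ (if lvl j = 0 then Ω₀ else Ω (lvl j)))
    (htol2 : ∀ j, j ≤ k → ε (lvl j) * P.eta (lvl j) ^ 2 ≤ α * P.eta j ^ 2)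
    (htol3 : ∀ j, j ≤ k → ε (lvl j) * P.eta (lvl j) ^ 3 ≤ α * P.eta j ^ 3) :
    InAk P.L k η α Ω' (fun x μ => ιSU N (U ⟨cover P (x + t), μ⟩)) := by
  have h := inAk_zdLift_of_top (N := N) U hP hD hη lvl hlvl hsub htol2 htol3
  rw [← inAk_translate_iff] at h
  exact h

end Lift

end Literature.MathematicalPhysics.QuantumFieldTheory.Balaban1983to89.Node00

end
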